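import Literature.MathematicalPhysics.QuantumFieldTheory.Balaban1983to89.T3AlphaInputsAC
import HarnessLib

/-!
# `Balaban1983to89.T3AlphaInputsACReadings` — PROVED READINGS of the (α) socket schemas of `T3AlphaInputsAC` (theorems only; successor
# module, no edit of the socket files): the summation step (44) ⇒ (45) of [Balaban1985UV3] p.267 under the coupled `TermSize`/`LocCover`
# clause, the order structure of the two `κ₁`-clauses, and print's regularity (68) at the TRIVIAL history on every fine plaquette

statement-level skeleton of published theorems with citation tags; proofs where landed; nothing here is a claim about the Yang–Mills mass gap.

Typer lineage (gen 41), page support for the consumers of the socket (crux 19201's S-E″ bookkeeping sums the localised terms over the domains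
containing a site and needs (68) for the trivial-history composite minimiser on all of `X̃`; crux 18916's S5 likewise).  Everything here is a
THEOREM over the hypothesis schemas of `T3AlphaInputsAC` (`TermSize` (44), `LocCover` (45), `Regularity68` (68), `TrivRegions`), with the
schemas as explicit hypotheses — no package predicate is assumed, nothing is asserted about Bałaban's data, no definition is introduced.

* §1 `locCover_mono` (a cover at rate `κ₁` is a cover at every larger rate), `termSize_anti` (a term size at rate `κ₁` is one at every smaller
  positive rate, constant replaced by its positive part), `coupled_of_le` (separately delivered `TermSize κ₁` + `LocCover κ₂`, `κ₂ ≤ κ₁`, give the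
  coupled clause `∃ C κ, TermSize C κ ∧ ∃ C′, LocCover κ C′` that the two-run bundle of crux 19201 carries).
* §2 `sum_indicator_abs_Pterm_le` — (45)'s SHAPE: under `TermSize C κ₁` and `LocCover κ₁ C′`, for an admissible pair `(h, W)` and `1 ≤ i ≤ j ≤ K`,
  `Σ_{Y ∈ Loc_i(h), Y ∋ y} |𝒫_i(Y, U_j(h,W))| ≤ max C 0 · C′ · θBal(K−j+1)² · L^{−4(j−i)}` — print: «By the assumption n ≥ 2, summation over all Y_j
  with y fixed yields for g_{k−1} sufficiently small Σ_{Y_j: y=y₀}|𝒫_j(Y_j, U_k)| ≤ O(1)(O(M₁³)g_{k−1}p(g_{k−1}))²(Lʲη)⁴» (45) p.267; and the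
  whole-sum form `sum_abs_Pterm_le_card_mul` over non-empty domains (`Σ_{Y ∈ Loc_i(h)} |𝒫_i| ≤ #sites · max C 0 · C′ · θBal² · L^{−4(j−i)}`,
  print's «Summation over y gives the factor (M₁Lʲη)^{−3}|Λ_k|» in the crude form `#T_η`).
* §3 `regularity68_triv` — (68) p.273 at the trivial history: with `TrivRegions` (all `Ω_i = T_η`, p.272) the regular region `Λ_j` is the whole
  torus, so EVERY fine plaquette `q` obeys `|U_j(W)(∂q) − 1| ≤ C68·g_jp(g_j)·L^{−2j}` for an admissible datum `W`.

References: T. Bałaban, CMP 102 (1985) 255–275 [Balaban1985UV3] ((44)–(46) p.267, (68) p.273, p.272).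
-/

noncomputable section

open Literature.MathematicalPhysics.QuantumFieldTheory.Balaban1983to89.T3ContinuumYM3Torus
open Literature.MathematicalPhysics.QuantumFieldTheory.Balaban1983to89.T3UnitScaleTilt
open Literature.MathematicalPhysics.QuantumFieldTheory.Balaban1983to89.T3AlphaInputsAC
open Literature.MathematicalPhysics.QuantumFieldTheory.Balaban1983to89.B10Eq38TorusDomains (cornerSet plaqsIn mem_plaqsIn_iff)
open Literature.MathematicalPhysics.QuantumFieldTheory.Balaban1983to89.B10Eq42TorusConstraint (lam42 lam42_self)

namespace Literature.MathematicalPhysics.QuantumFieldTheory.Balaban1983to89.T3AlphaInputsACReadings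

variable {F : T3Family} {γ : ℝ} {D : AlphaDataT3 F γ}

/-! ## §1 The order structure of the two `κ₁`-clauses -/

/-- `LocCover` is MONOTONE in the decay rate: a cover at rate `κ₁` is a cover at every `κ₂ ≥ κ₁` with the same constant (tree lengths are
non-negative, so the summands only decrease). [cite: Balaban1985UV3, (45) p.267] -/
theorem locCover_mono {κ₁ κ₂ C : ℝ} (h : LocCover D κ₁ C) (hle : κ₁ ≤ κ₂) : LocCover D κ₂ C := by
  refine ⟨h.1, fun K j hh i y => le_trans (Finset.sum_le_sum fun Y _ => ?_) (h.2 K j hh i y)⟩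
  refine Set.indicator_le_indicator (Real.exp_le_exp.mpr ?_)
  have ht := h.1 K i Y
  nlinarith

/-- `TermSize` is ANTITONE in the decay rate (up to replacing the constant by its positive part): a term size at rate `κ₁` is a term size at
every `0 < κ ≤ κ₁`, given non-negative tree lengths. [cite: Balaban1985UV3, (44) p.267] -/
theorem termSize_anti {b₀ p₀ C κ₁ κ : ℝ} (h : TermSize D b₀ p₀ C κ₁) (ht : ∀ K i Y, 0 ≤ D.treeLen K i Y) (hκ : 0 < κ) (hle : κ ≤ κ₁) :
    TermSize D b₀ p₀ (max C 0) κ := by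
  refine ⟨hκ, fun K j hh W hj hadm i hi hij Y hY => (h.2 K j hh W hj hadm i hi hij Y hY).trans ?_⟩
  have hexp : Real.exp (-κ₁ * D.treeLen K i Y) ≤ Real.exp (-κ * D.treeLen K i Y) := by
    refine Real.exp_le_exp.mpr ?_
    have := ht K i Y
    nlinarith
  calc C * Real.exp (-κ₁ * D.treeLen K i Y) * θBal F.L γ b₀ p₀ (K - j + 1) ^ 2 * (((F.L : ℝ) ^ (j - i))⁻¹) ^ 4
      ≤ max C 0 * Real.exp (-κ₁ * D.treeLen K i Y) * θBal F.L γ b₀ p₀ (K - j + 1) ^ 2 * (((F.L : ℝ) ^ (j - i))⁻¹) ^ 4 := by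
        gcongr; exact le_max_left C 0
    _ ≤ max C 0 * Real.exp (-κ * D.treeLen K i Y) * θBal F.L γ b₀ p₀ (K - j + 1) ^ 2 * (((F.L : ℝ) ^ (j - i))⁻¹) ^ 4 := by
        gcongr

/-- **COUPLING SEPARATELY DELIVERED CLAUSES**: a term size at rate `κ₁` and a cover at a rate `κ₂ ≤ κ₁` (`0 < κ₂`) give the coupled clause at `κ₂`
— the only direction in which the pair merges (a cover at a LARGER rate than the term size does not sum (44)). [cite: Balaban1985UV3, (44)-(45) p.267] -/
theorem coupled_of_le {b₀ p₀ C κ₁ κ₂ C' : ℝ} (hts : TermSize D b₀ p₀ C κ₁) (hcov : LocCover D κ₂ C') (hκ : 0 < κ₂) (hle : κ₂ ≤ κ₁) :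
    ∃ C κ : ℝ, TermSize D b₀ p₀ C κ ∧ ∃ C'' : ℝ, LocCover D κ C'' :=
  ⟨max C 0, κ₂, termSize_anti hts hcov.1 hκ hle, C', hcov⟩

/-- A cover constant can be taken non-negative. [cite: Balaban1985UV3, (45) p.267] -/
theorem locCover_max {κ₁ C : ℝ} (h : LocCover D κ₁ C) : LocCover D κ₁ (max C 0) :=
  ⟨h.1, fun K j hh i y => (h.2 K j hh i y).trans (le_max_left C 0)⟩

/-! ## §2 The summation step (44) ⇒ (45) -/

/-- **THE SUMMED TERM SIZE, (45)'s shape**: under the coupled clause, for an admissible pair the level-`i` terms localised around a fixed site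
sum to at most `max C 0 · C′ · θBal² · L^{−4(j−i)}` — «summation over all Y_j with y fixed yields …». [cite: Balaban1985UV3, (45) p.267] -/
theorem sum_indicator_abs_Pterm_le {b₀ p₀ C κ₁ C' : ℝ} (hts : TermSize D b₀ p₀ C κ₁) (hcov : LocCover D κ₁ C')
    {K j : ℕ} (hh : D.Hist K j) (W : GaugeField (F.P K) j (Matrix.specialUnitaryGroup (Fin 2) ℂ)) (hj : j ≤ K) (hadm : D.Adm K j hh W)
    {i : ℕ} (hi : 1 ≤ i) (hij : i ≤ j) (y : Site (F.P K) 0) :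
    ∑ Y ∈ D.Loc K j hh i, Y.indicator (fun _ => |D.Pterm K i Y (D.Umin K j hh W)|) y ≤
      max C 0 * C' * (θBal F.L γ b₀ p₀ (K - j + 1) ^ 2 * (((F.L : ℝ) ^ (j - i))⁻¹) ^ 4) := by
  have hθL : 0 ≤ θBal F.L γ b₀ p₀ (K - j + 1) ^ 2 * (((F.L : ℝ) ^ (j - i))⁻¹) ^ 4 := by positivity
  have hC0 : 0 ≤ max C 0 := le_max_right C 0
  have hterm : ∀ Y ∈ D.Loc K j hh i, Y.indicator (fun _ => |D.Pterm K i Y (D.Umin K j hh W)|) y ≤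
      max C 0 * (θBal F.L γ b₀ p₀ (K - j + 1) ^ 2 * (((F.L : ℝ) ^ (j - i))⁻¹) ^ 4) *
        Y.indicator (fun _ => Real.exp (-κ₁ * D.treeLen K i Y)) y := by
    intro Y hY
    by_cases hy : y ∈ Y
    · rw [Set.indicator_of_mem hy, Set.indicator_of_mem hy]
      calc |D.Pterm K i Y (D.Umin K j hh W)|
          ≤ C * Real.exp (-κ₁ * D.treeLen K i Y) * θBal F.L γ b₀ p₀ (K - j + 1) ^ 2 * (((F.L : ℝ) ^ (j - i))⁻¹) ^ 4 :=
            hts.2 K j hh W hj hadm i hi hij Y hY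
        _ ≤ max C 0 * Real.exp (-κ₁ * D.treeLen K i Y) * θBal F.L γ b₀ p₀ (K - j + 1) ^ 2 * (((F.L : ℝ) ^ (j - i))⁻¹) ^ 4 := by
            gcongr; exact le_max_left C 0
        _ = max C 0 * (θBal F.L γ b₀ p₀ (K - j + 1) ^ 2 * (((F.L : ℝ) ^ (j - i))⁻¹) ^ 4) * Real.exp (-κ₁ * D.treeLen K i Y) := by
            ring
    · rw [Set.indicator_of_notMem hy, Set.indicator_of_notMem hy, mul_zero]
  calc ∑ Y ∈ D.Loc K j hh i, Y.indicator (fun _ => |D.Pterm K i Y (D.Umin K j hh W)|) y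
      ≤ ∑ Y ∈ D.Loc K j hh i, max C 0 * (θBal F.L γ b₀ p₀ (K - j + 1) ^ 2 * (((F.L : ℝ) ^ (j - i))⁻¹) ^ 4) *
          Y.indicator (fun _ => Real.exp (-κ₁ * D.treeLen K i Y)) y := Finset.sum_le_sum hterm
    _ = max C 0 * (θBal F.L γ b₀ p₀ (K - j + 1) ^ 2 * (((F.L : ℝ) ^ (j - i))⁻¹) ^ 4) *
          ∑ Y ∈ D.Loc K j hh i, Y.indicator (fun _ => Real.exp (-κ₁ * D.treeLen K i Y)) y := by rw [Finset.mul_sum]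
    _ ≤ max C 0 * (θBal F.L γ b₀ p₀ (K - j + 1) ^ 2 * (((F.L : ℝ) ^ (j - i))⁻¹) ^ 4) * C' :=
          mul_le_mul_of_nonneg_left (hcov.2 K j hh i y) (mul_nonneg hC0 hθL)
    _ = max C 0 * C' * (θBal F.L γ b₀ p₀ (K - j + 1) ^ 2 * (((F.L : ℝ) ^ (j - i))⁻¹) ^ 4) := by ring

/-- **THE WHOLE LEVEL-`i` SUM, crude volume form**: if every summed domain is non-empty (print: «Localizations X are connected unions of big
blocks», (24) p.262), summing (45)'s shape over the sites of the fine torus bounds the whole sum of the level-`i` term sizes by `#T_η` times the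
per-site bound — print's «Summation over y gives the factor (M₁Lʲη)^{−3}|Λ_k|» (p.267, before (46)) with the big-block count replaced by the crude
site count. [cite: Balaban1985UV3, (45)-(46) p.267] -/
theorem sum_abs_Pterm_le_card_mul {b₀ p₀ C κ₁ C' : ℝ} (hts : TermSize D b₀ p₀ C κ₁) (hcov : LocCover D κ₁ C')
    {K j : ℕ} (hh : D.Hist K j) (W : GaugeField (F.P K) j (Matrix.specialUnitaryGroup (Fin 2) ℂ)) (hj : j ≤ K) (hadm : D.Adm K j hh W)
    {i : ℕ} (hi : 1 ≤ i) (hij : i ≤ j) (hne : ∀ Y ∈ D.Loc K j hh i, Y.Nonempty) :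
    ∑ Y ∈ D.Loc K j hh i, |D.Pterm K i Y (D.Umin K j hh W)| ≤
      (Fintype.card (Site (F.P K) 0) : ℝ) * (max C 0 * C' * (θBal F.L γ b₀ p₀ (K - j + 1) ^ 2 * (((F.L : ℝ) ^ (j - i))⁻¹) ^ 4)) := by
  classical
  -- each non-empty `Y` is counted at least once by the site sum of its indicator
  have hone : ∀ Y ∈ D.Loc K j hh i, |D.Pterm K i Y (D.Umin K j hh W)| ≤
      ∑ y : Site (F.P K) 0, Y.indicator (fun _ => |D.Pterm K i Y (D.Umin K j hh W)|) y := by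
    intro Y hY
    obtain ⟨y₀, hy₀⟩ := hne Y hY
    have h0 : ∀ y ∈ (Finset.univ : Finset (Site (F.P K) 0)), 0 ≤ Y.indicator (fun _ => |D.Pterm K i Y (D.Umin K j hh W)|) y :=
      fun y _ => Set.indicator_nonneg (fun _ _ => abs_nonneg _) y
    calc |D.Pterm K i Y (D.Umin K j hh W)| = Y.indicator (fun _ => |D.Pterm K i Y (D.Umin K j hh W)|) y₀ := by
          rw [Set.indicator_of_mem hy₀]
      _ ≤ ∑ y : Site (F.P K) 0, Y.indicator (fun _ => |D.Pterm K i Y (D.Umin K j hh W)|) y :=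
          Finset.single_le_sum h0 (Finset.mem_univ y₀)
  calc ∑ Y ∈ D.Loc K j hh i, |D.Pterm K i Y (D.Umin K j hh W)|
      ≤ ∑ Y ∈ D.Loc K j hh i, ∑ y : Site (F.P K) 0, Y.indicator (fun _ => |D.Pterm K i Y (D.Umin K j hh W)|) y :=
        Finset.sum_le_sum hone
    _ = ∑ y : Site (F.P K) 0, ∑ Y ∈ D.Loc K j hh i, Y.indicator (fun _ => |D.Pterm K i Y (D.Umin K j hh W)|) y :=
        Finset.sum_comm
    _ ≤ ∑ _y : Site (F.P K) 0, max C 0 * C' * (θBal F.L γ b₀ p₀ (K - j + 1) ^ 2 * (((F.L : ℝ) ^ (j - i))⁻¹) ^ 4) :=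
        Finset.sum_le_sum fun y _ => sum_indicator_abs_Pterm_le hts hcov hh W hj hadm hi hij y
    _ = (Fintype.card (Site (F.P K) 0) : ℝ) * (max C 0 * C' * (θBal F.L γ b₀ p₀ (K - j + 1) ^ 2 * (((F.L : ℝ) ^ (j - i))⁻¹) ^ 4)) := by
        rw [Finset.sum_const, Finset.card_univ, nsmul_eq_mul]

/-! ## §3 Print's regularity (68) at the trivial history -/

/-- **(68) AT THE TRIVIAL HISTORY BITES ON EVERY FINE PLAQUETTE**: with `TrivRegions` (all `Ω_i = T_η` at the trivial history, p.272 «all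
simplifications coming from the fact that Ω_{k+1} = T_η») the top regular region `Λ_j = Ω_j` is the whole torus, so for an admissible datum `W`
every plaquette `q` of the fine torus satisfies `|U_j(W)(∂q) − 1| ≤ C68·g_jp(g_j)·L^{−2j}` — (68) p.273 «the configuration U_k satisfies the
following regularity condition on B_j(Λ_j): |U_k(∂p) − 1| < O(1)g_jp(g_j)L^{−2j}». [cite: Balaban1985UV3, (68) p.273 and p.272] -/
theorem regularity68_triv {b₀ p₀ C68 : ℝ} (h68 : Regularity68 D b₀ p₀ C68) (htriv : TrivRegions D) {K j : ℕ}
    (W : GaugeField (F.P K) j (Matrix.specialUnitaryGroup (Fin 2) ℂ)) (hj : j ≤ K) (hadm : D.Adm K j (D.triv K j) W) (q : Plaq (F.P K) 0) :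
    GaugeGroup.dist1 (GaugeField.plaqHol (D.Umin K j (D.triv K j) W) q) ≤ C68 * θBal F.L γ b₀ p₀ (K - j) * (((F.L : ℝ) ^ j)⁻¹) ^ 2 := by
  refine h68 K j (D.triv K j) W hj hadm j le_rfl q ?_
  rw [mem_plaqsIn_iff]
  change cornerSet 0 q ⊆ lam42 (D.Ω K j (D.triv K j)) j j
  rw [lam42_self, htriv K j j]
  exact Set.subset_univ _

/-- The same on a datum in the route's small window, with admissibility supplied by `AdmOnSmall` (the form the S-E″ bookkeeping meets: the data are
`θBal(K − j)`-small). [cite: Balaban1985UV3, (68) p.273 and (47) p.267] -/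
theorem regularity68_triv_of_small {b₀ p₀ C68 : ℝ} (h68 : Regularity68 D b₀ p₀ C68) (htriv : TrivRegions D) (hadm : AdmOnSmall D b₀ p₀)
    {K j : ℕ} (W : GaugeField (F.P K) j (Matrix.specialUnitaryGroup (Fin 2) ℂ)) (hj : j ≤ K) (hW : PlaqSmall (θBal F.L γ b₀ p₀ (K - j)) W)
    (q : Plaq (F.P K) 0) :
    GaugeGroup.dist1 (GaugeField.plaqHol (D.Umin K j (D.triv K j) W) q) ≤ C68 * θBal F.L γ b₀ p₀ (K - j) * (((F.L : ℝ) ^ j)⁻¹) ^ 2 :=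
  regularity68_triv h68 htriv W hj (hadm K j W hj hW) q

end Literature.MathematicalPhysics.QuantumFieldTheory.Balaban1983to89.T3AlphaInputsACReadings

end
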